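import Summits.PneNP.PneNP.Theses.RootDecompQuantumCell

/-! # Root decomposition N19 (QuantumCell) — dichotomy of the typed oracle tests

Closes the record aside stmt-PneNP-32711 `QTestsDichotomy` of route
`route-PneNP-RootDecompQuantumCell` (decomp-pnenp cell; writer g7 rev 2, critic anchor 11:56:04Z):
under `P^B ⊆ BQP^B` for every `B` (tree `PRel_ofLanguage_subset_BQPRel`), the test `TQC`
(a collapsing world where `PP^B ⊄ BQP^B`) is equivalent to `TQL ∨ TQI`.

Port of the writer landing certificate `N19QC_landing-g7.lean` (`qTestsDichotomy_proof`):
pure logic over the route definitions (case split on `BQP^B ⊆ P^B`). Standard axioms only.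
-/

namespace Summit.PneNP.PneNP.Theorems

open Literature.Computability.Complexity
open Literature.Computability.Cryptography (BQPRel)

/-- DICHOTOMY of the typed tests of the counting-sandwich coordinate:
`(∀ B, P^B ⊆ BQP^B) → (TQC ↔ TQL ∨ TQI)`. Closes stmt-PneNP-32711. -/
theorem qTestsDichotomy_proof :
    Summit.PneNP.PneNP.Theses.RootDecompQuantumCell.QTestsDichotomy := by
  unfold Summit.PneNP.PneNP.Theses.RootDecompQuantumCell.QTestsDichotomy
    Summit.PneNP.PneNP.Theses.RootDecompQuantumCell.TQC
    Summit.PneNP.PneNP.Theses.RootDecompQuantumCell.TQL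
    Summit.PneNP.PneNP.Theses.RootDecompQuantumCell.TQI
  intro hPB
  constructor
  · rintro ⟨B, hc, hPQ⟩
    by_cases hQP : BQPRel B ⊆ PRel (Oracle.ofLanguage B)
    · exact Or.inl ⟨B, hc, hQP, fun hPP => hPQ (hPP.trans (hPB B))⟩
    · exact Or.inr ⟨B, hc, hQP, hPQ⟩
  · rintro (⟨B, hc, hQP, hPP⟩ | ⟨B, hc, _, hPQ⟩)
    · exact ⟨B, hc, fun hPQ => hPP (hPQ.trans hQP)⟩
    · exact ⟨B, hc, hPQ⟩

end Summit.PneNP.PneNP.Theorems
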